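import Literature.NumberTheory.GaloisRepresentations.ContinuousShapiroOpenCoinducedMackeyVanishing
import Literature.NumberTheory.GaloisCohomology.RestrictedRamificationExtComparisonLocalization
import Literature.GroupTheory.ProfiniteSubquotients
import HarnessLib

/-!
# `Шⁿ_S` of the LAYER `L ⊂ K_S` on the open subgroup `G_{L,S} ≤ G_{K,S}`, and the transport
# `Hⁿ(G_S, (Ind_{Γ_L}^{Γ_K} M)^{N_S}) ≃+ Hⁿ(G_S, Maps(G_S ⧸ G_{L,S}, M^{N_S}))` with its localisations
# (Milne I §4; Harari §17.2–17.3; NSW (1.5.6)–(1.6.5))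

Topic `NumberTheory/GaloisCohomology`; namespace `Literature.NumberTheory.GaloisCohomology.ShaLayer`.  Definitions
with bodies and theorems; NO named fact, no `sorry`, no instance, no notation.  File 3 of the (M7) «Ш-condition
transport under restricted Shapiro» series (files 1–2: `GaloisRepresentations/ContinuousShapiroOpenCoinducedMackey
{Degree,Vanishing}`; file 4: `ShaRestrictedShapiroLayer`, the transport theorem itself).

Setting (all of `K`, `M` in `Type`, as the tree's Poitou–Tate facts).  `K` a number field, `S` a set of finite
places, `N_S = ramificationSubgroup K S`, `G_S = GaloisGroupUnramifiedOutside K S = Γ_K ⧸ N_S`,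
`π = toUnramifiedQuot K S`; `ρ : DiscreteGaloisModule K M`, `M^{N_S} = ρ.quotientInvariants N_S` (the `G_S`-module of
the tree's `restrictedCohomology`); `N ⊴ Γ_K` an open normal subgroup — `N = Gal(K̄/L)` for a finite Galois `L/K`
— and `N̄ = N.map π ≤ G_S` its image (`= G_{L,S} = Gal(K_S/L)` when `L ⊂ K_S`, i.e. `N_S ≤ N`; this is cell
`bsd-print-cf2`'s `JohnsonLeungKings2011.imGS S N`, definitionally); `φ_v : Γ_{K_v} → G_S` the tree's
`RestrictedExt.localizationHom K S v` at a place `v : Place K`.  The induced module is the tree's permutation model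
`ρ.coindOpen N hN = Maps(Γ_K ⧸ N, M)` (`ContinuousShapiroOpenCoinduced`), a discrete `Γ_K`-module, so that
`restrictedCohomology (ρ.coindOpen N hN) S n = Hⁿ(G_S, Maps(Γ_K ⧸ N, M)^{N_S})` and `shaRestricted (ρ.coindOpen N hN)
S n = Шⁿ_S(K, Ind_N^{Γ_K} M)` are the objects to which `poitouTate_shaRestricted_tateDual(_natural_at)` applies.

## What is formalised

* §1 `isOpen_map_toUnramifiedQuot`; the local maps of the layer **`layerLocalization S ρ N v n : Hⁿ(N̄, M^{N_S}) →+ Hⁿ(φ_v⁻¹N̄, M^{N_S})`** (restriction along `φ_v⁻¹N̄ → N̄`;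
  `φ_v⁻¹N̄ = Γ_{L_w}` for the place `w ∣ v` of `L` singled out by the tree's embedding) and **`layerConj S ρ N σ̄ n`**
  (the tree's `conjMap` of `σ̄ ∈ G_S` on `Hⁿ(N̄, M^{N_S})`, moving `w` to its conjugates), and
  **`layerShaRestricted S ρ N n ≤ Hⁿ(N̄, M^{N_S})`** := `⨅_{w ∣ ∞, σ̄} ker (loc_w ∘ σ̄·) ⊓ ⨅_{v ∈ S, σ̄} ker (loc_v ∘ σ̄·)`
  — `Шⁿ_S(L, M)` of the layer in the place-by-place formalism (the places of `L` above `v` ↔ the double cosets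
  `Γ_{K_v} \\ Γ_K / Γ_L` ↔ the conjugates of the embedded one; same shape as the tree's Greenberg–Vatsal Selmer groups
  `⨅ σ, comap (conjH1 σ) (…)`), with `mem_layerShaRestricted_iff(_place)`.
* §2 (hypotheses `hNS : N_S ≤ N`, `hρ : N_S ≤ ker ρ`): `cosetEquiv` (`G_S ⧸ N̄ ≃* Γ_K ⧸ N`, third isomorphism
  theorem), **`mapsEquiv : Maps(Γ_K ⧸ N, M) ≃ₜ+ Maps(G_S ⧸ N̄, M^{N_S})`** with `mapsEquiv_apply_mk_mk`, `mapsEquiv_smul`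
  (equivariance along `Γ_K ↠ G_S`), `mapsEquiv_symm_mem_invariants`, **`invariantsEquiv : Maps(Γ_K ⧸ N, M)^{N_S} ≃ₜ+
  Maps(G_S ⧸ N̄, M^{N_S})`** (`G_S`-equivariant: `invariantsEquiv_map`), **`restrictedCohomologyEquiv n :
  restrictedCohomology (ρ.coindOpen N hN) S n ≃+ Hⁿ(G_S, coindFin (M^{N_S}) N̄)`** (the continuous-cohomology
  transport `continuousCohomologyAddEquiv`), and the LOCALISATION CORRESPONDENCE
  **`transport_restrictedLocalization`** / **`restrictedLocalization_eq_zero_iff`**: `loc_v c = 0` iff the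
  transported class restricts to zero along `φ_v` (naturality `continuousCohomologyAddEquiv_map` +
  `RestrictedExt.restrictedLocalization_eq_map`).

Written by the width seat `bsd-line-cf2c-w3` g9 of cell `bsd-print-cf2` (idle-width item (M7), planner ruling (N-PT)
2026-08-29; consumer: ROW 1 of the JLK descent on the deciding child `MainConjClauseAtSplitTwoQuadDA`).  HONEST
FRAMING: bookkeeping of continuous cohomology; no arithmetic duality and no case of BSD is proved here.

## References
* J. S. Milne, *Arithmetic Duality Theorems*, 2nd ed. (2006), Ch. I §4 (pp. 55–57). [MilneADT2006]
* D. Harari, *Galois Cohomology and Class Field Theory* (2020), Def. 15.36, §17.2 (p. 290), §17.3 (p. 294),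
  Remark 17.7 (b). [Harari2020]
* J. Neukirch, A. Schmidt, K. Wingberg, *Cohomology of Number Fields*, 2nd ed. (2008), I §5 (1.5.6)–(1.5.7),
  I §6 (1.6.4)–(1.6.5). [NeukirchSchmidtWingberg2008]
* J.-P. Serre, *Local Fields* (1979), VII §5. [SerreLocalFields1979]
* L. Ribes, P. Zalesskii, *Profinite Groups*, 2nd ed. (2010), Prop. 2.2.1. [RibesZalesskii2010]
-/

noncomputable section

open CategoryTheory Function NumberField Field IsDedekindDomain
open scoped NumberField Classical

namespace Literature.NumberTheory.GaloisCohomology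

open Literature.NumberTheory.GaloisRepresentations
open Literature.NumberTheory.GaloisRepresentations.DiscreteGaloisModule (restrictedCohomology
  restrictedLocalization shaRestricted quotientInvariants)
open _root_.TopRep

namespace ShaLayer

variable {K : Type} [Field K] [NumberField K] (S : Set (HeightOneSpectrum (𝓞 K)))
variable {M : Type} [AddCommGroup M] [TopologicalSpace M] [DiscreteTopology M] (ρ : DiscreteGaloisModule K M)
variable (N : Subgroup (absoluteGaloisGroup K)) [N.Normal] (hN : IsOpen (N : Set (absoluteGaloisGroup K)))

/-! ## §1 The layer group `G_{L,S} = N̄ ≤ G_S`, its local maps, and `Шⁿ_S` of the layer -/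

-- `G_S` is totally disconnected: the tree's `Greenberg2006.totallyDisconnectedSpace_galoisGroupUnramifiedOutside`
-- (`IwasawaTheory/Greenberg2006/TwistDeformationLEO.lean`); to keep the imports light the sequel inlines its
-- one-line proof `ProfiniteSubquotients.totallyDisconnectedSpace_quotient N_S (ramificationSubgroup_isClosed K S)`.

omit [NumberField K] [N.Normal] in
include hN in
/-- The image `N̄ = G_{L,S}` of an open `N = Gal(K̄/L)` is open in `G_S`. [cite: Harari2020, Def. 15.36] -/
theorem isOpen_map_toUnramifiedQuot :
    IsOpen ((N.map (toUnramifiedQuot K S) : Subgroup (GaloisGroupUnramifiedOutside K S)) :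
      Set (GaloisGroupUnramifiedOutside K S)) :=
  isOpenMap_toUnramifiedQuot K S _ hN

/-- **The local map of the layer at a place `v` of `K`**: restriction
`Hⁿ(N̄, M^{N_S}) → Hⁿ(φ_v⁻¹N̄, M^{N_S})` along `φ_v : Γ_{K_v} → G_S` restricted to `φ_v⁻¹N̄ → N̄` — for
`N = Gal(K̄/L)` and the tree's embedding `Γ_{K_v} → Γ_K`, `φ_v⁻¹N̄ = Γ_{L_w}` for the place `w ∣ v` of `L` singled out
by the embedding, so this is "restriction to `L_w`"; the other places of `L` above `v` are reached by first
conjugating the class (`layerConj`). [cite: Harari2020, §17.2 (p. 290)] [cite: NeukirchSchmidtWingberg2008, I §5 (1.5.6)–(1.5.7)] -/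
def layerLocalization (v : Place K) (n : ℕ) :
    (continuousCohomology n (subgroupRep (ρ.quotientInvariants (ramificationSubgroup K S)).toTopRep
        (N.map (toUnramifiedQuot K S))) : Type) →+
      (continuousCohomology n (subgroupRep
        (TopRep.res (RestrictedExt.localizationHom K S v :
            absoluteGaloisGroup (Place.Completion v) →* GaloisGroupUnramifiedOutside K S)
          (ρ.quotientInvariants (ramificationSubgroup K S)).toTopRep)
        ((N.map (toUnramifiedQuot K S)).comap
          (RestrictedExt.localizationHom K S v :
            absoluteGaloisGroup (Place.Completion v) →* GaloisGroupUnramifiedOutside K S))) : Type) :=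
  (ContinuousCohomology.map (comapSubtypeHom (N.map (toUnramifiedQuot K S)) (RestrictedExt.localizationHom K S v))
    (comapCoeffHom (ρ.quotientInvariants (ramificationSubgroup K S)).toTopRep (N.map (toUnramifiedQuot K S))
      (RestrictedExt.localizationHom K S v)) n).hom.toLinearMap.toAddMonoidHom

/-- **The action of `σb ∈ G_S` on `Hⁿ(N̄, M^{N_S})`** (the tree's `conjMap`; for `σb ∉ N̄` it moves the place
`w ∣ v` singled out by the embedding to its conjugate `σ w`). [cite: SerreLocalFields1979, VII §5]
[cite: NeukirchSchmidtWingberg2008, I §5 (1.5.6)–(1.5.7)] -/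
def layerConj (σ : GaloisGroupUnramifiedOutside K S) (n : ℕ) :
    (continuousCohomology n (subgroupRep (ρ.quotientInvariants (ramificationSubgroup K S)).toTopRep
        (N.map (toUnramifiedQuot K S))) : Type) →+
      (continuousCohomology n (subgroupRep (ρ.quotientInvariants (ramificationSubgroup K S)).toTopRep
        (N.map (toUnramifiedQuot K S))) : Type) :=
  (conjMap (ρ.quotientInvariants (ramificationSubgroup K S)).toTopRep (N.map (toUnramifiedQuot K S)) σ n
    ).hom.toLinearMap.toAddMonoidHom

omit [NumberField K] in
/-- Unfolding `layerConj`. [cite: SerreLocalFields1979, VII §5] -/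
theorem layerConj_apply (σ : GaloisGroupUnramifiedOutside K S) (n : ℕ)
    (z : continuousCohomology n (subgroupRep (ρ.quotientInvariants (ramificationSubgroup K S)).toTopRep
        (N.map (toUnramifiedQuot K S)))) :
    layerConj S ρ N σ n z =
      (conjMap (ρ.quotientInvariants (ramificationSubgroup K S)).toTopRep (N.map (toUnramifiedQuot K S)) σ n).hom z :=
  rfl

/-- **`Шⁿ_S(L, M) ≤ Hⁿ(G_{L,S}, M^{N_S})` of the LAYER `L = K̄^N` in the place-by-place formalism**: the classes
`z ∈ Hⁿ(N̄, M^{N_S})` (`N̄ = G_{L,S} ≤ G_{K,S}`) such that for EVERY `σb ∈ G_S` the conjugate `σb · z` restricts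
to zero along `φ_w⁻¹N̄ → N̄` at every infinite place `w` of `K` and along `φ_v⁻¹N̄ → N̄` at every `v ∈ S` — i.e.
`z` is locally trivial at every place of `L` above `S ∪ Ω_∞` (the places of `L` above `v` are the double cosets
`Γ_{K_v} \ Γ_K / Γ_L`, i.e. the conjugates of the embedded one; same shape as the tree's Greenberg–Vatsal Selmer
groups `⨅ σ, comap (conjH1 σ) (…)`).  This is Milne's / Harari's `Шⁿ_S(L, M)` for the finite extension `L/K`
inside `K_S`, written on the open subgroup `G_{L,S} ≤ G_{K,S}` rather than on `Γ_L` of the field `L`.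
[cite: MilneADT2006, Ch. I §4 (p. 56)] [cite: Harari2020, §17.3 (p. 294)] [cite: NeukirchSchmidtWingberg2008, I §5 (1.5.6)–(1.5.7)] -/
def layerShaRestricted (n : ℕ) :
    AddSubgroup (continuousCohomology n (subgroupRep (ρ.quotientInvariants (ramificationSubgroup K S)).toTopRep
      (N.map (toUnramifiedQuot K S)))) :=
  (⨅ (w : InfinitePlace K) (σ : GaloisGroupUnramifiedOutside K S),
      ((layerLocalization S ρ N (Sum.inl w) n).comp (layerConj S ρ N σ n)).ker) ⊓
    ⨅ (v : HeightOneSpectrum (𝓞 K)) (_ : v ∈ S) (σ : GaloisGroupUnramifiedOutside K S),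
      ((layerLocalization S ρ N (Sum.inr v) n).comp (layerConj S ρ N σ n)).ker

/-- Membership in `Шⁿ_S` of the layer. [cite: MilneADT2006, Ch. I §4 (p. 56)] -/
theorem mem_layerShaRestricted_iff (n : ℕ)
    (z : continuousCohomology n (subgroupRep (ρ.quotientInvariants (ramificationSubgroup K S)).toTopRep
        (N.map (toUnramifiedQuot K S)))) :
    z ∈ layerShaRestricted S ρ N n ↔
      (∀ (w : InfinitePlace K) (σ : GaloisGroupUnramifiedOutside K S),
          layerLocalization S ρ N (Sum.inl w) n (layerConj S ρ N σ n z) = 0) ∧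
        ∀ v ∈ S, ∀ σ : GaloisGroupUnramifiedOutside K S,
          layerLocalization S ρ N (Sum.inr v) n (layerConj S ρ N σ n z) = 0 := by
  simp only [layerShaRestricted, AddSubgroup.mem_inf, AddSubgroup.mem_iInf, AddMonoidHom.mem_ker,
    AddMonoidHom.coe_comp, comp_apply]

/-- Place-uniform form of the membership. [cite: MilneADT2006, Ch. I §4 (p. 56)] -/
theorem mem_layerShaRestricted_iff_place (n : ℕ)
    (z : continuousCohomology n (subgroupRep (ρ.quotientInvariants (ramificationSubgroup K S)).toTopRep
        (N.map (toUnramifiedQuot K S)))) :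
    z ∈ layerShaRestricted S ρ N n ↔
      ∀ v : Place K, (∀ v₀ : HeightOneSpectrum (𝓞 K), v = Sum.inr v₀ → v₀ ∈ S) →
        ∀ σ : GaloisGroupUnramifiedOutside K S, layerLocalization S ρ N v n (layerConj S ρ N σ n z) = 0 := by
  rw [mem_layerShaRestricted_iff]
  constructor
  · rintro ⟨h₁, h₂⟩ (w | v) hv σ
    · exact h₁ w σ
    · exact h₂ v (hv v rfl) σ
  · intro h
    exact ⟨fun w σ => h (Sum.inl w) (fun v₀ hv₀ => by cases hv₀) σ,
      fun v hv σ => h (Sum.inr v) (fun v₀ hv₀ => by cases hv₀; exact hv) σ⟩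

/-! ## §2 `Maps(Γ_K ⧸ N, M)^{N_S} ≅ Maps(G_S ⧸ N̄, M^{N_S})` and the transport of `restrictedCohomology` -/

section Transport

variable (hNS : ramificationSubgroup K S ≤ N) (hρ : ramificationSubgroup K S ≤ ContinuousRep.ker ρ)

omit [NumberField K] [N.Normal] in
include hρ in
/-- For `M` unramified outside `S`, every vector is `N_S`-invariant. [cite: Harari2020, Def. 15.36 and Remark 17.7 (b)] -/
theorem mem_invariants_of_le_ker (m : M) :
    m ∈ Representation.invariants (ρ.toRepresentation.comp (ramificationSubgroup K S).subtype) := by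
  rw [Representation.mem_invariants]
  intro g
  have hg : ρ g = LinearMap.id := (ContinuousRep.mem_ker ρ g).1 (hρ g.2)
  rw [MonoidHom.comp_apply, Subgroup.coe_subtype, ContinuousRep.toRepresentation_apply, hg, LinearMap.id_apply]

/-- The bijection of coset spaces `G_S ⧸ N̄ ≃ Γ_K ⧸ N` (third isomorphism theorem for `N_S ≤ N`).
[cite: Harari2020, Def. 15.36] -/
def cosetEquiv : GaloisGroupUnramifiedOutside K S ⧸ N.map (toUnramifiedQuot K S) ≃* absoluteGaloisGroup K ⧸ N :=
  QuotientGroup.quotientQuotientEquivQuotient (ramificationSubgroup K S) N hNS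

omit [NumberField K] in
/-- `cosetEquiv` on classes of classes. [cite: Harari2020, Def. 15.36] -/
@[simp]
theorem cosetEquiv_mk_mk (g : absoluteGaloisGroup K) :
    cosetEquiv S N hNS (QuotientGroup.mk (QuotientGroup.mk g : GaloisGroupUnramifiedOutside K S)) =
      (QuotientGroup.mk g : absoluteGaloisGroup K ⧸ N) :=
  QuotientGroup.quotientQuotientEquivQuotientAux_mk_mk _ _ hNS g

/-- **`Maps(Γ_K ⧸ N, M) ≃ₜ+ Maps(G_S ⧸ N̄, M^{N_S})`**, `φ ↦ (yb ↦ φ(e yb))` along `e : G_S ⧸ N̄ ≃ Γ_K ⧸ N` (both sides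
discrete; values are `N_S`-invariant because `M` is unramified outside `S`). [cite: Harari2020, Def. 15.36]
[cite: NeukirchSchmidtWingberg2008, I §6 (induced modules)] -/
def mapsEquiv : (absoluteGaloisGroup K ⧸ N → M) ≃ₜ+
    (GaloisGroupUnramifiedOutside K S ⧸ N.map (toUnramifiedQuot K S) →
      Representation.invariants (ρ.toRepresentation.comp (ramificationSubgroup K S).subtype)) :=
  haveI : DiscreteTopology (absoluteGaloisGroup K ⧸ N → M) := ContinuousRep.discreteTopology_coindOpen N hN
  haveI : DiscreteTopology (GaloisGroupUnramifiedOutside K S ⧸ N.map (toUnramifiedQuot K S) →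
      Representation.invariants (ρ.toRepresentation.comp (ramificationSubgroup K S).subtype)) :=
    ContinuousRep.discreteTopology_coindOpen (N.map (toUnramifiedQuot K S)) (isOpen_map_toUnramifiedQuot S N hN)
  { toFun := fun φ yb => ⟨φ (cosetEquiv S N hNS yb), mem_invariants_of_le_ker S ρ hρ _⟩
    invFun := fun F y => (F ((cosetEquiv S N hNS).symm y) : M)
    left_inv := fun φ => funext fun y => by
      change (φ (cosetEquiv S N hNS ((cosetEquiv S N hNS).symm y))) = φ y
      rw [MulEquiv.apply_symm_apply]
    right_inv := fun F => funext fun yb => Subtype.ext (by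
      change (F ((cosetEquiv S N hNS).symm (cosetEquiv S N hNS yb)) : M) = F yb
      rw [MulEquiv.symm_apply_apply])
    map_add' := fun _ _ => rfl
    continuous_toFun := continuous_of_discreteTopology
    continuous_invFun := continuous_of_discreteTopology }

/-- Values of `mapsEquiv` on classes of classes. [cite: Harari2020, Def. 15.36] -/
@[simp]
theorem mapsEquiv_apply_mk_mk (φ : absoluteGaloisGroup K ⧸ N → M) (g : absoluteGaloisGroup K) :
    ((mapsEquiv S ρ N hN hNS hρ φ (QuotientGroup.mk (QuotientGroup.mk g : GaloisGroupUnramifiedOutside K S)) :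
      Representation.invariants (ρ.toRepresentation.comp (ramificationSubgroup K S).subtype)) : M) =
      φ (QuotientGroup.mk g : absoluteGaloisGroup K ⧸ N) := by
  change φ (cosetEquiv S N hNS _) = _
  rw [cosetEquiv_mk_mk]

/-- **Equivariance of `mapsEquiv` along `Γ_K ↠ G_S`**: `mapsEquiv (g ⋆ φ) = ḡ ⋆ mapsEquiv φ` for the diagonal
actions (`(g ⋆ φ)(y) = g • φ(g⁻¹ y)`). [cite: NeukirchSchmidtWingberg2008, I §6 (induced modules)] -/
theorem mapsEquiv_smul (g : absoluteGaloisGroup K) (φ : absoluteGaloisGroup K ⧸ N → M) :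
    mapsEquiv S ρ N hN hNS hρ ((ρ.coindOpen N hN) g φ) =
      (coindFin.{0, 0} (ρ.quotientInvariants (ramificationSubgroup K S)).toTopRep (N.map (toUnramifiedQuot K S))).ρ
        (toUnramifiedQuot K S g) (mapsEquiv S ρ N hN hNS hρ φ) := by
  funext yb
  obtain ⟨x, rfl⟩ := QuotientGroup.mk_surjective yb
  obtain ⟨y, rfl⟩ := QuotientGroup.mk_surjective x
  apply Subtype.ext
  have h1 : (toUnramifiedQuot K S g)⁻¹ •
      (QuotientGroup.mk (QuotientGroup.mk y : GaloisGroupUnramifiedOutside K S) :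
        GaloisGroupUnramifiedOutside K S ⧸ N.map (toUnramifiedQuot K S)) =
      QuotientGroup.mk (QuotientGroup.mk (g⁻¹ * y) : GaloisGroupUnramifiedOutside K S) := by
    rw [MulAction.Quotient.smul_mk, smul_eq_mul, QuotientGroup.mk_mul, QuotientGroup.mk_inv]
    rfl
  have h2 : g⁻¹ • (QuotientGroup.mk y : absoluteGaloisGroup K ⧸ N) = QuotientGroup.mk (g⁻¹ * y) := by
    rw [MulAction.Quotient.smul_mk, smul_eq_mul]
  have hL : ((mapsEquiv S ρ N hN hNS hρ ((ρ.coindOpen N hN) g φ)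
      (QuotientGroup.mk (QuotientGroup.mk y : GaloisGroupUnramifiedOutside K S)) :
      Representation.invariants (ρ.toRepresentation.comp (ramificationSubgroup K S).subtype)) : M) =
      ρ g (φ (QuotientGroup.mk (g⁻¹ * y))) := by
    rw [mapsEquiv_apply_mk_mk, ContinuousRep.coindOpen_apply_apply, h2]
  have hR : (((coindFin.{0, 0} (ρ.quotientInvariants (ramificationSubgroup K S)).toTopRep
        (N.map (toUnramifiedQuot K S))).ρ (toUnramifiedQuot K S g) (mapsEquiv S ρ N hN hNS hρ φ)
      (QuotientGroup.mk (QuotientGroup.mk y : GaloisGroupUnramifiedOutside K S)) :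
      Representation.invariants (ρ.toRepresentation.comp (ramificationSubgroup K S).subtype)) : M) =
      ρ g (φ (QuotientGroup.mk (g⁻¹ * y))) := by
    rw [coindFin_ρ_apply, h1]
    change ρ g (mapsEquiv S ρ N hN hNS hρ φ _ : M) = _
    rw [mapsEquiv_apply_mk_mk]
  exact hL.trans hR.symm

/-- The inverse of `mapsEquiv` lands in the `N_S`-invariants of `Maps(Γ_K ⧸ N, M)` (`N_S ≤ N` acts trivially
on `Γ_K ⧸ N` and on `M`). [cite: Harari2020, Def. 15.36 and Remark 17.7 (b)] -/
theorem mapsEquiv_symm_mem_invariants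
    (F : GaloisGroupUnramifiedOutside K S ⧸ N.map (toUnramifiedQuot K S) →
      Representation.invariants (ρ.toRepresentation.comp (ramificationSubgroup K S).subtype)) :
    (mapsEquiv S ρ N hN hNS hρ).symm F ∈
      Representation.invariants ((ρ.coindOpen N hN).toRepresentation.comp (ramificationSubgroup K S).subtype) := by
  rw [Representation.mem_invariants]
  intro n
  change (ρ.coindOpen N hN) (n : absoluteGaloisGroup K) ((mapsEquiv S ρ N hN hNS hρ).symm F) = _
  apply (mapsEquiv S ρ N hN hNS hρ).injective
  have h1 : toUnramifiedQuot K S (n : absoluteGaloisGroup K) = 1 := (QuotientGroup.eq_one_iff _).2 n.2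
  rw [mapsEquiv_smul, ContinuousAddEquiv.apply_symm_apply, h1, map_one]
  rfl

/-- **`Maps(Γ_K ⧸ N, M)^{N_S} ≃ₜ+ Maps(G_S ⧸ N̄, M^{N_S})`** (restriction of `mapsEquiv` to the `N_S`-invariants,
which are everything: `N_S ≤ N` acts trivially on `Γ_K ⧸ N` and on `M`). [cite: Harari2020, Def. 15.36 and Remark 17.7 (b)] -/
def invariantsEquiv :
    Representation.invariants ((ρ.coindOpen N hN).toRepresentation.comp (ramificationSubgroup K S).subtype) ≃ₜ+
      (GaloisGroupUnramifiedOutside K S ⧸ N.map (toUnramifiedQuot K S) →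
        Representation.invariants (ρ.toRepresentation.comp (ramificationSubgroup K S).subtype)) where
  toFun w := mapsEquiv S ρ N hN hNS hρ (w : absoluteGaloisGroup K ⧸ N → M)
  invFun F := ⟨(mapsEquiv S ρ N hN hNS hρ).symm F, mapsEquiv_symm_mem_invariants S ρ N hN hNS hρ F⟩
  left_inv _ := Subtype.ext ((mapsEquiv S ρ N hN hNS hρ).symm_apply_apply _)
  right_inv F := (mapsEquiv S ρ N hN hNS hρ).apply_symm_apply F
  map_add' w w' := map_add (mapsEquiv S ρ N hN hNS hρ) (w : absoluteGaloisGroup K ⧸ N → M) w'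
  continuous_toFun := (mapsEquiv S ρ N hN hNS hρ).continuous.comp continuous_subtype_val
  continuous_invFun := (mapsEquiv S ρ N hN hNS hρ).symm.continuous.subtype_mk _

/-- `invariantsEquiv w = mapsEquiv w.1`. [cite: Harari2020, Def. 15.36] -/
@[simp]
theorem invariantsEquiv_apply
    (w : Representation.invariants ((ρ.coindOpen N hN).toRepresentation.comp (ramificationSubgroup K S).subtype)) :
    invariantsEquiv S ρ N hN hNS hρ w = mapsEquiv S ρ N hN hNS hρ (w : absoluteGaloisGroup K ⧸ N → M) := rfl

/-- `invariantsEquiv` is `G_S`-equivariant. [cite: NeukirchSchmidtWingberg2008, I §6 (induced modules)] -/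
theorem invariantsEquiv_map [N.FiniteIndex] (σ : GaloisGroupUnramifiedOutside K S)
    (w : Representation.invariants ((ρ.coindOpen N hN).toRepresentation.comp (ramificationSubgroup K S).subtype)) :
    invariantsEquiv S ρ N hN hNS hρ (((ρ.coindOpen N hN).quotientInvariants (ramificationSubgroup K S)) σ w) =
      (coindFin.{0, 0} (ρ.quotientInvariants (ramificationSubgroup K S)).toTopRep (N.map (toUnramifiedQuot K S))).ρ
        σ (invariantsEquiv S ρ N hN hNS hρ w) := by
  obtain ⟨g, rfl⟩ := toUnramifiedQuot_surjective K S σ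
  exact mapsEquiv_smul S ρ N hN hNS hρ g w

/-- **The transport `Hⁿ(G_S, Maps(Γ_K ⧸ N, M)^{N_S}) ≃+ Hⁿ(G_S, Maps(G_S ⧸ N̄, M^{N_S}))`** — the left side is the
tree's `restrictedCohomology (ρ.coindOpen N hN) S n = Hⁿ(G_S, (Ind_N^{Γ_K} M)^{N_S})`, the right side the
permutation model of the `G_S`-module `M^{N_S}` along the open `N̄` (the continuous-cohomology transport along
`invariantsEquiv`). [cite: Harari2020, §17.2 (p. 290)] [cite: NeukirchSchmidtWingberg2008, I §6 (induced modules)] -/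
def restrictedCohomologyEquiv [N.FiniteIndex] (n : ℕ) :
    (restrictedCohomology (ρ.coindOpen N hN) S n : Type) ≃+
      (continuousCohomology n (coindFin.{0, 0} (ρ.quotientInvariants (ramificationSubgroup K S)).toTopRep
        (N.map (toUnramifiedQuot K S))) : Type) :=
  continuousCohomologyAddEquiv
    (X := ((ρ.coindOpen N hN).quotientInvariants (ramificationSubgroup K S)).toTopRep)
    (Y := coindFin.{0, 0} (ρ.quotientInvariants (ramificationSubgroup K S)).toTopRep (N.map (toUnramifiedQuot K S)))
    (invariantsEquiv S ρ N hN hNS hρ) (invariantsEquiv_map S ρ N hN hNS hρ) n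

/-- **The localisations correspond** (equation form): transporting `loc_v c ∈ Hⁿ(K_v, Maps(Γ_K⧸N, M))` along
`mapsEquiv` gives the restriction of the transported class along `φ_v : Γ_{K_v} → G_S` (naturality of the
transport: on coefficients `loc_v` is the inclusion `Maps^{N_S} ⊆ Maps` over `Γ_{K_v}`,
`RestrictedExt.restrictedLocalization_eq_map`, which `mapsEquiv` carries to the identity of
`Maps(G_S ⧸ N̄, M^{N_S})|_{φ_v}`). [cite: Harari2020, §17.2 (p. 290)] -/
theorem transport_restrictedLocalization [N.FiniteIndex] (v : Place K) (n : ℕ)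
    (c : restrictedCohomology (ρ.coindOpen N hN) S n) :
    continuousCohomologyAddEquiv
        (X := (DiscreteGaloisModule.toLocal (ρ.coindOpen N hN) v).toTopRep)
        (Y := TopRep.res (RestrictedExt.localizationHom K S v :
            absoluteGaloisGroup (Place.Completion v) →* GaloisGroupUnramifiedOutside K S)
          (coindFin.{0, 0} (ρ.quotientInvariants (ramificationSubgroup K S)).toTopRep (N.map (toUnramifiedQuot K S))))
        (mapsEquiv S ρ N hN hNS hρ)
        (fun τ φ => mapsEquiv_smul S ρ N hN hNS hρ (absGaloisRestrict K (Place.Completion v) τ) φ) n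
        (restrictedLocalization (ρ.coindOpen N hN) S v n c) =
      (ContinuousCohomology.map (RestrictedExt.localizationHom K S v)
        (𝟙 (TopRep.res (RestrictedExt.localizationHom K S v :
            absoluteGaloisGroup (Place.Completion v) →* GaloisGroupUnramifiedOutside K S)
          (coindFin.{0, 0} (ρ.quotientInvariants (ramificationSubgroup K S)).toTopRep (N.map (toUnramifiedQuot K S)))))
        n).hom (restrictedCohomologyEquiv S ρ N hN hNS hρ n c) := by
  rw [RestrictedExt.restrictedLocalization_eq_map]
  exact continuousCohomologyAddEquiv_map
    (X := ((ρ.coindOpen N hN).quotientInvariants (ramificationSubgroup K S)).toTopRep)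
    (X' := coindFin.{0, 0} (ρ.quotientInvariants (ramificationSubgroup K S)).toTopRep (N.map (toUnramifiedQuot K S)))
    (Y := (DiscreteGaloisModule.toLocal (ρ.coindOpen N hN) v).toTopRep)
    (Y' := TopRep.res (RestrictedExt.localizationHom K S v :
        absoluteGaloisGroup (Place.Completion v) →* GaloisGroupUnramifiedOutside K S)
      (coindFin.{0, 0} (ρ.quotientInvariants (ramificationSubgroup K S)).toTopRep (N.map (toUnramifiedQuot K S))))
    (invariantsEquiv S ρ N hN hNS hρ) (invariantsEquiv_map S ρ N hN hNS hρ)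
    (mapsEquiv S ρ N hN hNS hρ)
    (fun τ φ => mapsEquiv_smul S ρ N hN hNS hρ (absGaloisRestrict K (Place.Completion v) τ) φ)
    (RestrictedExt.localizationHom K S v) (RestrictedExt.localizationCoeff v (ρ.coindOpen N hN)) (𝟙 _)
    (fun _ => rfl) n c

/-- **The localisations correspond**: `loc_v c = 0` in `Hⁿ(K_v, Maps(Γ_K⧸N, M))` iff the transported class
restricts to zero along `φ_v : Γ_{K_v} → G_S`. [cite: Harari2020, §17.2 (p. 290)] -/
theorem restrictedLocalization_eq_zero_iff [N.FiniteIndex] (v : Place K) (n : ℕ)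
    (c : restrictedCohomology (ρ.coindOpen N hN) S n) :
    restrictedLocalization (ρ.coindOpen N hN) S v n c = 0 ↔
      (ContinuousCohomology.map (RestrictedExt.localizationHom K S v)
        (𝟙 (TopRep.res (RestrictedExt.localizationHom K S v :
            absoluteGaloisGroup (Place.Completion v) →* GaloisGroupUnramifiedOutside K S)
          (coindFin.{0, 0} (ρ.quotientInvariants (ramificationSubgroup K S)).toTopRep (N.map (toUnramifiedQuot K S)))))
        n).hom (restrictedCohomologyEquiv S ρ N hN hNS hρ n c) = 0 := by
  have h := transport_restrictedLocalization S ρ N hN hNS hρ v n c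
  constructor
  · intro h0
    rw [h0] at h
    exact h.symm.trans (map_zero _)
  · intro h0
    rw [h0] at h
    exact (AddEquiv.map_eq_zero_iff _).1 h

end Transport

end ShaLayer

end Literature.NumberTheory.GaloisCohomology

end
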